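import Summits.QuantumFields.YangMills.Theorems.BalabanUVNodesN05SubBPT8SrvGammaPrime
import Literature.MathematicalPhysics.QuantumFieldTheory.Balaban1983to89.B8LeafKnitZdGF3PGammaPrime
import Literature.MathematicalPhysics.QuantumFieldTheory.Balaban1983to89.B8Prop3PrintedZdGF3PGamma
import Literature.MathematicalPhysics.QuantumFieldTheory.Balaban1983to89.B8SockSP5UniformThresholdsSrcGammaPrime

/-!
# BalabanUVNodes ∕ N05 ([Balaban1985RegularSpaces] Lemma 1 p. 79 – Thm 8 p. 101): THE RE-PINNED [B8] SLOT `Node00.CarriersB8SubBP.B8LeafOfRecordSubBP` AT THE CUT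
# LAYER, KNIT ON THE γ′ SOCKET FAMILY — `B8LeafOfRecordSubBP θ (λ.cutSubB J lan c₁)` from [4]'s letters, the three b9 sockets and Theorem 8's constants at the
# `Ω₀ = ℤᵈ` law members, Proposition 5 ∃∕! (at `lan`), Proposition 6 and Proposition 7 DISPLAYED; inside: dag-n05-w2's γ′ leaf `b8LeafRS_zdGF3HP_mapJ_γ'`
# (Lemma 1, Thm 2, Thm 4), this seat's `prop3Printed_zdGF3P_map_γ` (Prop 3), this seat's `t8P_famB8OfRecordSubBP_of_socketsSrc_γ'` (Thm 8 surviving), the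
# sockets SERVED by dag-n05-w4's γ′ uniform thresholds (D9b of the §n05 γ chain — the successor of p521275 on the P-slot)

Track A of `YM-PLAN.md` (cell `pub-ymgap`, HUMAN RULING D-0062), node **N05**; seat `pub-ymgap-dag-n05-d` (g10), 2026-08-28; bears on K1⁷ `stmt-QuantumFields-20542`
(`--supports … --as helper`, count-neutral).  THE STORY IN ONE PARAGRAPH.  The N05 knit of record (`BalabanUVNodesN05SubBHKnitUnivT8Srv`, p521275) concluded the
slot `B8LeafOfRecordSubBH`, which this seat certified EMPTY as typed (`B8Prop3ShellModeVacuity.not_b8LeafOfRecordSubBH`, p585094: Proposition 3's (1.42) hypothesis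
read on the member's own class has no crossing bond).  The carrier was re-typed (dag-n05-w1 `B8LeafModelZd3P.zdGF3HP`: (1.35)∕(1.66) in print's one-end-point class,
(1.37)∕(1.42)∕(1.145) over print's class `towerBondsP`), the slot re-pinned (`Node00.CarriersB8SubBP`, p592605), and the whole [B8] chain re-run in edition γ′:
Theorem 4 (this seat's `B8Thm4ConcreteLanEGamma` ∕ `B8Thm4CoreZdGF3HPLanEGamma`, dag-n05-w2's `B8Thm4ZdGF3PMapGammaPrime`), Theorem 2 (dag-n05-w2
`B8Thm2ZdGF3PMapGammaPrime`), Proposition 3 (this seat's `B8Prop3PrintedZdGF3PGamma`), Theorem 8 surviving (this seat's `B8Thm8SurvivingZdGF3HPMapLanEGamma` +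
`BalabanUVNodesN05SubBPT8SrvGammaPrime`), the Prop-5-type sourced socket providers (dag-n05-w4's `…SrcGammaPrime` chain), the leaf assembly (dag-n05-w2
`B8LeafKnitZdGF3PGammaPrime.b8LeafRS_zdGF3HP_mapJ_γ'`).  THIS FILE closes the loop at the record's four-law `Ω₀ = ℤᵈ` sub-index `IdxB8SubB θ` (`ι := (·.1.1)`).

WHAT IS PROVED (composition BY NAME; no estimate; no new definition):
* ★★ **`b8LeafOfRecordSubBP_cutSubB_of_knit_lettersSrc_γ'`** — `B8LeafOfRecordSubBP θ (λ.cutSubB J lan c₁)` from: [4]'s letters at the `Ω₀ = ℤᵈ` law members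
  (`SLet`, `SLetUB`), the sourceless b9 socket of Prop. 3's frame over print's class (`SB9P`, threshold `cB9`), Theorem 8's constants `c59 cP3 γ₈ γ′ γ″ γβ B₈ B₈β`
  with the layer equations `λ.B₁′ = 5dL·B₈` (Thm 4's constant at Thm 8's enlarged `B₈`), `λ.B₁ = 5dL·B₈·(1+11d²)`, `λ.B₂ = 5dL·B₈β·(1+11d²)`,
  `λ.C₂ = 2097152(d+1)²L²` (the (1.61) constant: `≥` for Prop. 3, `≤` for Thm 2's use of it), the sourced free-constant guard, the two sourced b9 sockets
  (`SH59src` at (1.146) in Thm 4's frame, γ′ letter, `c59`; `SB9srcHP` in Prop. 3's frame, `cP3`) — all at law members ONLY —, Proposition 5 ∃∕! at the family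
  `lan` (`p5e p5u`), Proposition 6 on the record's cube family at `c₁` (`p6`), Proposition 7 at the P-members (`p7`) — the last four DISPLAYED.
HONEST FRAMING: kernel bookkeeping by name; the sockets are HYPOTHESES ([4]-type statements — letters Thm 3.1, b9 Thm 3.3 (sourceless and with source) — and their
satisfiability is the N06 lineage's content (m = 0 inhabited by the tree's γ′∕univ witnesses, m ≥ 1 OPEN), NOT claimed); `p5e p5u p6 p7` are N05's own printed members
NOT discharged here; count-neutral; **N05 NOT discharged**; Bałaban AS PRINTED with locators; constants sufficient, not optimal; one finite 𝕋⁴ programme at fixed ε;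
nothing continuum ∕ ℝ⁴ ∕ OS ∕ mass-gap ∕ Clay.  No `sorry`, no new definition.  Unit `pub-ymgap-dag-n05-d` (g10), 2026-08-28.
[cite: Balaban1985RegularSpaces, Lemma 1 p.79, Thm 2 p.83, Prop. 3 p.87 + (1.61), Thm 4 p.88, Prop. 5 (1.106)–(1.110) p.94, Prop. 6 (1.131)–(1.133) p.99, Prop. 7 p.100, Thm 8 (1.146) p.101, (1.31) p.82, (1.35) p.82, p.77; Balaban1985BackgroundPropagators, Thm 3.1 p.397, Thm 3.3 p.398]
-/

noncomputable section

namespace Summit.QuantumFields.YangMills.BalabanUVNodes.N05SubBPKnitGammaPrime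

open Literature.MathematicalPhysics.QuantumFieldTheory.Balaban1983to89
open Literature.MathematicalPhysics.QuantumFieldTheory.Balaban1983to89.Node00
open Literature.MathematicalPhysics.QuantumFieldTheory.Balaban1983to89.B8IdxB8LawsB (IdxB8LawsB IdxB8SubB)
open Literature.MathematicalPhysics.QuantumFieldTheory.Balaban1983to89.B8LeafModelZd (ZdIdx)
open Literature.MathematicalPhysics.QuantumFieldTheory.Balaban1983to89.B8LeafModelZd3 (SockB9P3)
open Literature.MathematicalPhysics.QuantumFieldTheory.Balaban1983to89.B8LeafModelZd3P (zdGF3P zdGF3HP)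
open Literature.MathematicalPhysics.QuantumFieldTheory.Balaban1983to89.B8TowerBondsPrinted (towerBondsP)
open Literature.MathematicalPhysics.QuantumFieldTheory.Balaban1983to89.B8SockLettersRD (SockLettersRD)
open Literature.MathematicalPhysics.QuantumFieldTheory.Balaban1983to89.B8Lemma1NonAbelian (mulCfg blockPairNA)
open Literature.MathematicalPhysics.QuantumFieldTheory.Balaban1983to89.B8LeafKnitZdGF3PGammaPrime (b8LeafRS_zdGF3HP_mapJ_γ')
open Literature.MathematicalPhysics.QuantumFieldTheory.Balaban1983to89.B8Prop3PrintedZdGF3PGamma (prop3Printed_zdGF3P_map_γ)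
open Literature.MathematicalPhysics.QuantumFieldTheory.Balaban1983to89.B8SockSP5UniformThresholdsSrcGammaPrime (exists_uniform_threshold_sp5_src_γ' exists_uniform_threshold_sp5base_src_γ' exists_uniform_threshold_sp5u_src_γ')
open Literature.MathematicalPhysics.QuantumFieldTheory.Balaban1983to89.B8LanF146 (LanF146 lanF146_zero_iff)
open Literature.MathematicalPhysics.QuantumFieldTheory.Balaban1983to89.B8Eq138LandauZd (covLap QT InR138 IsLandau146W inR138_zero)
open Summit.QuantumFields.YangMills.BalabanUVNodes.N05SubBPT8SrvGammaPrime (t8P_famB8OfRecordSubBP_of_socketsSrc_γ')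
open MatrixLog B7Prop1Explicit B7Prop2Explicit B7Prop1Local B7Eq92Concrete
open B8Ineq130 (tlo thi)
open B8Ineq132 (InAk covDerivFwd)
open B7Eq78Linearization (zdBlocking QprimeIter)
open B8Eq119TwistedAxial (bgT Restr129 InAx)
open B8Eq140Level (SideTouches)
open B8Eq1117Concrete (XSpace)
open B8Prop5ContractionKLevel (Bd2)
open B8LambdaSpaceKLevel (wt)
open B8Eq184Proof (gaugeExp cfgExp)
open B8Eq146AExpansion (iEta plaqCovDeriv)
open B8Eq143PlaqExpansion (pdiv)
open B7Prop4GeneralLevels (linCovIter)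
open B8Eq155JBound (Jcur wsup)
open B8ScaledSupNorm (bondNorm msup Bdd msup_le bdd_of_forall)
open B9Eq340HolderZd (hquot AdmPair)

-- `Site` alone could resolve to the torus sites of `Setup.lean`; re-export the `ℤ^d` sites of `B7Prop1Explicit`.
export B7Prop1Explicit (Site)

section KnitP

/-- ★★ **THE RE-PINNED [B8] SLOT AT THE CUT LAYER, KNIT ON THE γ′ SOCKET FAMILY, SOCKETS SERVED** — for the record's `θ` (`D ≥ 2`), residual layer `λ`, any
Proposition-5 family `lan : J → B8.LandauData` and Prop.-6 threshold `c₁`: from [4]'s letters (`SLet`, `SLetUB`) and the sourceless b9 socket of Prop. 3's frame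
(`SB9P`, `cB9`) at the `Ω₀ = ℤᵈ` law members, Theorem 8's constants with the four layer equations and the sourced free-constant guard, the two SOURCED b9 sockets
`SH59src` (`c59`) ∕ `SB9srcHP` (`cP3`) at the law members, and the displayed `p5e p5u p6 p7`: the slot `B8LeafOfRecordSubBP θ (λ.cutSubB J lan c₁)`.  PROOF:
`SP5base`∕`SP5`∕`SP5u` (γ′) below ONE member-uniform threshold from dag-n05-w4's `exists_uniform_threshold_sp5{base,,u}_src_γ'` (class laws of print's class by
`B8TowerBondsPrinted.ZdIdx.towerBondsP_laws`, tower laws `IdxB8Laws.tower_all` ∕ `ZdIdx.htower`, №8 `trunc_lt`∕`trunc_top`); `hP3 := prop3Printed_zdGF3P_map_γ`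
at `ι := (·.1.1)`; `t8 := t8P_famB8OfRecordSubBP_of_socketsSrc_γ'`; the leaf by dag-n05-w2's `b8LeafRS_zdGF3HP_mapJ_γ'` at `ι := (·.1.1)`, `Φ := Site → 𝔸`,
`Adm :=` Theorem 8's source premiss ρ2, `LanF := LanF146`, zero source `φ₀ := 0` (`inR138_zero`, `lanF146_zero_iff`); read into the slot by dag-n05-w1's
`b8LeafOfRecordSubBP_cutSubB_iff` (`famB8OfRecordSubBP θ β len j = zdGF3HP θ.𝔸 θ.L β len j.1.1` by `rfl`).
[cite: Balaban1985RegularSpaces, Lemma 1 p.79, Thm 2 p.83, Prop. 3 p.87, Thm 4 p.88, Prop. 5 p.94, Prop. 6 p.99, Prop. 7 p.100, Thm 8 (1.146) p.101; Balaban1985BackgroundPropagators, Thm 3.1 p.397, Thm 3.3 p.398] -/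
theorem b8LeafOfRecordSubBP_cutSubB_of_knit_lettersSrc_γ' {θ : Stage3Params} (lam : ResidB8 θ) (hD : 2 ≤ θ.D)
    {cB9 B₀'H B₂' BG BR cL : ℝ}
    (hC₂eq : lam.C₂ = 2097152 * ((θ.D : ℝ) + 1) ^ 2 * (θ.L : ℝ) ^ 2)
    (hcB9 : 0 < cB9) (hB₀'H : 0 < B₀'H) (hB₂' : 0 ≤ B₂') (hBG : 0 ≤ BG) (hBR : 0 ≤ BR) (hcL : 0 < cL)
    -- [4]'s letters AT THE `Ω₀ = ℤᵈ` LAW MEMBERS ONLY: existence side (laws on print's domains) and uniqueness side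
    (SLet : ∀ i : ZdIdx θ.D θ.L, i.Ω 0 = Set.univ → IdxB8LawsB θ.L i → SockLettersRD (𝔸 := θ.𝔸) θ.L BG BR B₀'H B₂' cL i.η i.k i.Ω i.Λs)
    (SLetUB : ∀ i : ZdIdx θ.D θ.L, i.Ω 0 = Set.univ → IdxB8LawsB θ.L i → ∀ α₀ : ℝ, 0 < α₀ → α₀ ≤ cL → ∀ U₀ : Site θ.D → Fin θ.D → θ.𝔸ˣ, (∀ x κ, U₀ x κ ∈ unitaryUnits θ.𝔸) →
      InAk θ.L i.k i.η α₀ i.Ω U₀ →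
      ∃ (g Δ : (Site θ.D → θ.𝔸) →ₗ[ℂ] (Site θ.D → θ.𝔸)) (q : (Site θ.D → θ.𝔸) →ₗ[ℂ] (ℕ → Site θ.D → θ.𝔸))
        (qs : (ℕ → Site θ.D → θ.𝔸) →ₗ[ℂ] (Site θ.D → θ.𝔸)) (Aw c : (ℕ → Site θ.D → θ.𝔸) →ₗ[ℂ] (ℕ → Site θ.D → θ.𝔸))
        (H' : XSpace θ.D i.k θ.𝔸 →ₗ[ℂ] (Site θ.D → θ.𝔸)),
        (∀ x : Site θ.D → θ.𝔸, (∃ C : ℝ, ∀ y, ‖x y‖ ≤ C) → g (Δ x + qs (Aw (q x))) = x) ∧ (∀ φ, qs (c (q (g (g (qs φ))))) = qs φ) ∧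
        (∀ (f : Site θ.D → θ.𝔸), ∀ x ∈ i.Ω 0, Δ f x = covLap i.η U₀ ((i.Ω 0).indicator f) x) ∧
        (∀ (μ : ℕ → Site θ.D → θ.𝔸), ∀ x ∈ i.Ω 0, qs μ x = QT θ.L i.k (i.Λs i.k) U₀ μ x) ∧
        (∀ (f : Site θ.D → θ.𝔸) (n : ℕ), n ≤ i.k → ∀ y ∈ i.Λs i.k n, q f n y = QprimeIter (zdBlocking θ.D θ.L) (bgT θ.L U₀) n f y) ∧
        (∀ (f : Site θ.D → θ.𝔸) (n : ℕ) (y : Site θ.D), ¬ (n ≤ i.k ∧ y ∈ i.Λs i.k n) → q f n y = 0) ∧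
        (∀ (X : XSpace θ.D i.k θ.𝔸) (x : Site θ.D), ‖H' X x‖ ≤ B₀'H * ‖X‖) ∧
        (∀ n, n ≤ i.k → ∀ (X : XSpace θ.D i.k θ.𝔸), ∀ p ∈ {b : Site θ.D × Fin θ.D | SideTouches (i.Ω n) b.1 b.2},
          wt θ.L i.η n * ‖covDerivFwd i.η U₀ p.2 (H' X) p.1‖ ≤ B₀'H * ‖X‖) ∧
        (∀ X : XSpace θ.D i.k θ.𝔸, Bd2 θ.L i.η i.k i.Ω (covLap i.η U₀ (H' X)) (B₂' * ‖X‖)) ∧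
        (∀ (Y : XSpace θ.D i.k θ.𝔸) (n : ℕ) (hn : n ≤ i.k) (y : Site θ.D), y ∈ i.Λs i.k n →
          QprimeIter (zdBlocking θ.D θ.L) (bgT θ.L U₀) n (H' Y) y = Y (⟨n, Nat.lt_succ_of_le hn⟩, y)) ∧
        (∀ (f : Site θ.D → θ.𝔸) (r : ℝ), 0 ≤ r → Bd2 θ.L i.η i.k i.Ω f r →
          (∀ x, ‖g f x‖ ≤ BG * r) ∧ ∀ n, n ≤ i.k → ∀ p ∈ {b : Site θ.D × Fin θ.D | SideTouches (i.Ω n) b.1 b.2},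
            wt θ.L i.η n * ‖covDerivFwd i.η U₀ p.2 (g f) p.1‖ ≤ BG * r) ∧
        (∀ (f : Site θ.D → θ.𝔸) (r : ℝ), 0 ≤ r → Bd2 θ.L i.η i.k i.Ω f r → Bd2 θ.L i.η i.k i.Ω (f - g (qs (c (q (g f))))) (BR * r)))
    -- the SOURCELESS b9 socket of Proposition 3's frame over PRINT's class, at the law members only ([4] Thm 3.3; threshold `cB9`) — for Prop. 3 AS PRINTED
    (SB9P : ∀ i : ZdIdx θ.D θ.L, i.Ω 0 = Set.univ → IdxB8LawsB θ.L i →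
      SockB9P3 (𝔸 := θ.𝔸) θ.L lam.inp.B₀ lam.B₀β cB9 lam.β lam.len i.η i.k i.Ω i.Λs (fun m j => towerBondsP θ.L i.Ω (i.Λs m) j))
    -- PROPOSITION 5 at an arbitrary family `lan`, PROPOSITION 6 on the record's cube family at `c₁`, PROPOSITION 7 at the P-members — DISPLAYED
    {J : Type} {lan : J → B8.LandauData}
    (p5e : B8.Prop5Exists lam.inp.B₀' lam.B₁ lan) (p5u : B8.Prop5Unique lan)
    (c₁ : ℝ) (p6 : B8.Prop6Printed θ.D (θ.L : ℝ) lam.B₁ c₁ (fun j : IdxB8SubB θ => cubB8OfRecord θ j.1))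
    (p7 : B8SectGH.Prop7PrintedR (fun j : IdxB8SubB θ => famB8OfRecordSubBP θ lam.β lam.len j) (fun j => lam.toAxial j.1))
    -- THEOREM 8's CONSTANTS, the layer equations, the sourced free-constant guard, the two SOURCED b9 sockets at the law members
    {c59 cP3 γ₈ γ' γ'' γβ B₈ B₈β : ℝ} (hc59 : 0 < c59) (hcP3 : 0 < cP3) (hγ₈ : 1 ≤ γ₈) (hγ' : 0 ≤ γ') (hγ'' : 0 ≤ γ'')
    (hB : 2 ≤ 5 * (θ.D : ℝ) * θ.L * lam.inp.B₀) (hB₀β : 0 < lam.B₀β) (hB₀8 : lam.inp.B₀ ≤ B₈)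
    (hγB : 5 * (θ.D : ℝ) * θ.L * lam.inp.B₀ + 2 * (γ' * lam.inp.B₀) ≤ 5 * (θ.D : ℝ) * θ.L * B₈)
    (hγB'' : 5 * (θ.D : ℝ) * θ.L * lam.inp.B₀ + 2 * (γ'' * lam.inp.B₀) ≤ 5 * (θ.D : ℝ) * θ.L * B₈)
    (hB8β : 5 * (θ.D : ℝ) * θ.L * lam.B₀β + 2 * lam.B₀β * (γ'' * lam.inp.B₀) + γβ ≤ 5 * (θ.D : ℝ) * θ.L * B₈β)
    (hB₁' : lam.B₁' = 5 * (θ.D : ℝ) * θ.L * B₈)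
    (hB₁eq : lam.B₁ = 5 * (θ.D : ℝ) * θ.L * B₈ * (1 + 11 * (θ.D : ℝ) ^ 2)) (hB₂eq : lam.B₂ = 5 * (θ.D : ℝ) * θ.L * B₈β * (1 + 11 * (θ.D : ℝ) ^ 2))
    (hfreeS : 3 * (2 * (θ.D : ℝ) * (θ.L : ℝ) ^ 2) * BG * BR * (B₈ + γ₈) ≤ lam.inp.B₀' * B₈)
    -- [Balaban1985BackgroundPropagators] Thm 3.3 WITH SOURCE in Theorem 4's frame at (1.146), γ′ letter, threshold `c59`, at the law members ONLY — HYPOTHESIS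
    (SH59src : ∀ i : ZdIdx θ.D θ.L, i.Ω 0 = Set.univ → IdxB8LawsB θ.L i → ∀ α₀ α₁ : ℝ, 0 < α₀ → 0 < α₁ → α₀ + α₁ ≤ c59 →
      ∀ U₀ U' : Site θ.D → Fin θ.D → θ.𝔸ˣ, (∀ x κ, U₀ x κ ∈ unitaryUnits θ.𝔸) → (∀ x κ, U' x κ ∈ unitaryUnits θ.𝔸) →
      ∀ φ : Site θ.D → θ.𝔸, ((InR138 θ.L i.k i.η (i.Ω 0) (i.Λs i.k) U₀ φ ∧ (∀ x, IsSelfAdjoint (φ x)) ∧ (∀ x, x ∉ i.Ω 0 → φ x = 0) ∧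
          Bdd θ.L i.k i.η (-(2 : ℝ)) (fun j (x : Site θ.D) => x ∈ i.Ω j) φ) ∧
        msup θ.L i.k i.η (-(2 : ℝ)) (fun j (x : Site θ.D) => x ∈ i.Ω j) φ < γ₈ * (α₀ + α₁)) →
      InAk θ.L i.k i.η α₀ i.Ω U₀ → InAk θ.L i.k i.η α₀ i.Ω (mulCfg U' U₀) → (∀ m, m ≤ i.k → InAx θ.L m (i.Λs m) U₀ (mulCfg U' U₀)) →
      (∀ j, j ≤ i.k → ∀ (z : Site θ.D) (μ : Fin θ.D),
        ((∀ x, InBox (tlo θ.L z j) (thi θ.L z j) x → x ∈ i.Ω j) ∨ (∀ x, InBox (tlo θ.L (z + e μ) j) (thi θ.L (z + e μ) j) x → x ∈ i.Ω j)) →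
        ‖(avgIter θ.L (mulCfg U' U₀) j z μ : θ.𝔸) - (avgIter θ.L U₀ j z μ : θ.𝔸)‖ ≤ α₁) →
      (∀ b ∈ {b : Site θ.D × Fin θ.D | SideTouches (i.Ω 0) b.1 b.2}, ‖((U' b.1 b.2 : θ.𝔸ˣ) : θ.𝔸) - 1‖ ≤ α₁) →
      (∀ m, 1 ≤ m → m ≤ i.k → ∀ (u : Site θ.D → θ.𝔸ˣ) (W : Site θ.D → Fin θ.D → θ.𝔸ˣ) (A' : Site θ.D → Fin θ.D → θ.𝔸),
        (∀ x, u x ∈ unitaryUnits θ.𝔸) → mgauge U₀ u W = U' → Restr129 θ.L m (i.Λs m) U₀ u → LanF146 θ.L i.k i.η (i.Ω 0) i.Λs U₀ φ m W →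
        (∀ y τ, IsSelfAdjoint (A' y τ)) →
        (∀ j, j ≤ m → ∀ y τ, SideTouches (i.Ω j) y τ →
        W y τ = cfgExp i.η A' y τ ∧ ‖A' y τ‖ ≤ (2 * (θ.L * (5 * (θ.D : ℝ) * θ.L * B₈ * (α₀ + α₁))) + 8 * (8 * lam.inp.B₀' * (5 * (θ.D : ℝ) * θ.L * B₈) * (α₀ + α₁))) * ((θ.L : ℝ) ^ j * i.η)⁻¹) →
        (∀ y τ, (∀ j, j ≤ m → ¬ SideTouches (i.Ω j) y τ) → A' y τ = 0) →
        msup θ.L m i.η (-(1 : ℝ)) (fun j (b : Site θ.D × Fin θ.D) => SideTouches (i.Ω j) b.1 b.2) (fun b => A' b.1 b.2)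
        ≤ lam.inp.B₀ * (bondNorm θ.L m i.η (-(3 : ℝ)) i.Ω (fun x μ => Jcur i.η U₀ A' μ x)
        + wsup 1 (fun p : {p : ℕ × (Site θ.D × Fin θ.D) // p.1 ≤ m ∧ p.2 ∈ towerBondsP θ.L i.Ω (i.Λs m) p.1} =>
        linCovIter θ.L U₀ (iEta i.η A') p.1.1 p.1.2.1 p.1.2.2)) + γ' * lam.inp.B₀ * (α₀ + α₁) ∧
        msup θ.L m i.η (-(2 : ℝ)) (fun j (t : Fin θ.D × Fin θ.D × Site θ.D) => SideTouches (i.Ω j) t.2.2 t.2.1)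
        (fun t => covDerivFwd i.η U₀ t.1 (fun z => A' z t.2.1) t.2.2)
        ≤ lam.inp.B₀ * (bondNorm θ.L m i.η (-(3 : ℝ)) i.Ω (fun x μ => Jcur i.η U₀ A' μ x)
        + wsup 1 (fun p : {p : ℕ × (Site θ.D × Fin θ.D) // p.1 ≤ m ∧ p.2 ∈ towerBondsP θ.L i.Ω (i.Λs m) p.1} =>
        linCovIter θ.L U₀ (iEta i.η A') p.1.1 p.1.2.1 p.1.2.2)) + γ' * lam.inp.B₀ * (α₀ + α₁)))
    -- THE SOURCED b9 SOCKET OF PROPOSITION 3's FRAME at the `Ω₀ = ℤᵈ` law members, threshold `cP3`, `|B₁|` over print's class at the top truncation — HYPOTHESIS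
    -- ([Balaban1985BackgroundPropagators] Thm 3.3 with source; = `B8Prop3SrcZd3HPGamma`'s input letter for letter)
    (SB9srcHP : ∀ i : ZdIdx θ.D θ.L, i.Ω 0 = Set.univ → IdxB8LawsB θ.L i → ∀ α₀ α₁ α₂ : ℝ, 0 < α₀ → α₀ ≤ cP3 → 0 < α₁ → 0 < α₂ → α₂ ≤ cP3 →
      ∀ (U₀ W : Site θ.D → Fin θ.D → θ.𝔸ˣ), (∀ x κ, U₀ x κ ∈ unitaryUnits θ.𝔸) → (∀ x κ, W x κ ∈ unitaryUnits θ.𝔸) →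
      ∀ f : Site θ.D → θ.𝔸, InR138 θ.L i.k i.η (i.Ω 0) (i.Λs i.k) U₀ f →
      (∀ x, IsSelfAdjoint (f x)) → (∀ x, x ∉ i.Ω 0 → f x = 0) →
      Bdd θ.L i.k i.η (-(2 : ℝ)) (fun j (x : Site θ.D) => x ∈ i.Ω j) f →
      msup θ.L i.k i.η (-(2 : ℝ)) (fun j (x : Site θ.D) => x ∈ i.Ω j) f < γ₈ * (α₀ + α₁) →
      msup θ.L i.k i.η (-(3 : ℝ)) (fun j (p : Fin θ.D × Site θ.D) => p.2 ∈ i.Ω j) (fun p => covDerivFwd i.η U₀ p.1 f p.2) < γ₈ * (α₀ + α₁) →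
      InAk θ.L i.k i.η α₀ i.Ω U₀ → InAk θ.L i.k i.η α₀ i.Ω (mulCfg W U₀) → IsLandau146W θ.L i.k i.η (i.Ω 0) (i.Λs i.k) U₀ f W →
      ∀ A' : Site θ.D → Fin θ.D → θ.𝔸, (∀ y τ, IsSelfAdjoint (A' y τ)) →
      (∀ j, j ≤ i.k → ∀ (y : Site θ.D) (τ : Fin θ.D), SideTouches (i.Ω j) y τ →
        W y τ = cfgExp i.η A' y τ ∧ ‖A' y τ‖ ≤ α₂ * ((θ.L : ℝ) ^ j * i.η)⁻¹) →
      (∀ (y : Site θ.D) (τ : Fin θ.D), (∀ j, j ≤ i.k → ¬ SideTouches (i.Ω j) y τ) → A' y τ = 0) →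
      msup θ.L i.k i.η (-(1 : ℝ)) (fun j (b : Site θ.D × Fin θ.D) => SideTouches (i.Ω j) b.1 b.2) (fun b => A' b.1 b.2)
          ≤ lam.inp.B₀ * (bondNorm θ.L i.k i.η (-(3 : ℝ)) i.Ω (fun x μ => Jcur i.η U₀ A' μ x)
            + wsup 1 (fun p : {p : ℕ × (Site θ.D × Fin θ.D) // p.1 ≤ i.k ∧ p.2 ∈ towerBondsP θ.L i.Ω (i.Λs i.k) p.1} =>
                linCovIter θ.L U₀ (iEta i.η A') p.1.1 p.1.2.1 p.1.2.2)) + γ'' * lam.inp.B₀ * (α₀ + α₁) ∧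
        msup θ.L i.k i.η (-(2 : ℝ)) (fun j (t : Fin θ.D × Fin θ.D × Site θ.D) => SideTouches (i.Ω j) t.2.2 t.2.1)
            (fun t => covDerivFwd i.η U₀ t.1 (fun z => A' z t.2.1) t.2.2)
          ≤ lam.inp.B₀ * (bondNorm θ.L i.k i.η (-(3 : ℝ)) i.Ω (fun x μ => Jcur i.η U₀ A' μ x)
            + wsup 1 (fun p : {p : ℕ × (Site θ.D × Fin θ.D) // p.1 ≤ i.k ∧ p.2 ∈ towerBondsP θ.L i.Ω (i.Λs i.k) p.1} =>
                linCovIter θ.L U₀ (iEta i.η A') p.1.1 p.1.2.1 p.1.2.2)) + γ'' * lam.inp.B₀ * (α₀ + α₁) ∧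
        bondNorm θ.L i.k i.η (-(3 : ℝ)) i.Ω (fun x μ => pdiv i.η U₀ (plaqCovDeriv i.η U₀ A') μ x)
          ≤ lam.inp.B₀ * (bondNorm θ.L i.k i.η (-(3 : ℝ)) i.Ω (fun x μ => Jcur i.η U₀ A' μ x)
            + wsup 1 (fun p : {p : ℕ × (Site θ.D × Fin θ.D) // p.1 ≤ i.k ∧ p.2 ∈ towerBondsP θ.L i.Ω (i.Λs i.k) p.1} =>
                linCovIter θ.L U₀ (iEta i.η A') p.1.1 p.1.2.1 p.1.2.2)) + γ'' * lam.inp.B₀ * (α₀ + α₁) ∧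
        bondNorm θ.L i.k i.η (-(3 : ℝ)) i.Ω (fun x μ => covLap i.η U₀ (fun z => A' z μ) x)
          ≤ lam.inp.B₀ * (bondNorm θ.L i.k i.η (-(3 : ℝ)) i.Ω (fun x μ => Jcur i.η U₀ A' μ x)
            + wsup 1 (fun p : {p : ℕ × (Site θ.D × Fin θ.D) // p.1 ≤ i.k ∧ p.2 ∈ towerBondsP θ.L i.Ω (i.Λs i.k) p.1} =>
                linCovIter θ.L U₀ (iEta i.η A') p.1.1 p.1.2.1 p.1.2.2)) + γ'' * lam.inp.B₀ * (α₀ + α₁) ∧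
        msup θ.L i.k i.η (-(2 + lam.β)) (fun j (q : Fin θ.D × Fin θ.D × (Site θ.D × Site θ.D)) => q.2.2 ∈ AdmPair i.η lam.len ∧ q.2.2.1 ∈ i.Ω j)
            (fun q => hquot i.η lam.β lam.len U₀ (covDerivFwd i.η U₀ q.1 (fun z => A' z q.2.1)) q.2.2)
          ≤ lam.B₀β * (bondNorm θ.L i.k i.η (-(3 : ℝ)) i.Ω (fun x μ => Jcur i.η U₀ A' μ x)
            + wsup 1 (fun p : {p : ℕ × (Site θ.D × Fin θ.D) // p.1 ≤ i.k ∧ p.2 ∈ towerBondsP θ.L i.Ω (i.Λs i.k) p.1} =>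
                linCovIter θ.L U₀ (iEta i.η A') p.1.1 p.1.2.1 p.1.2.2)) + γβ * (α₀ + α₁)) :
    B8LeafOfRecordSubBP θ (lam.cutSubB J lan c₁) := by
  -- constants: `0 < B₀ ≤ B₈`, `2 ≤ 5dLB₀ ≤ 5dLB₈`, `0 ≤ γ₈`, `2γ′B₀ ≤ 5dLB₈`
  have hB₀ : 0 < lam.inp.B₀ := lam.inp.B₀_pos
  have hB₈ : 0 < B₈ := lt_of_lt_of_le hB₀ hB₀8
  have h5 : 0 ≤ 5 * (θ.D : ℝ) * θ.L := by positivity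
  have hB8' : 2 ≤ 5 * (θ.D : ℝ) * θ.L * B₈ := hB.trans (mul_le_mul_of_nonneg_left hB₀8 h5)
  have hγ₈0 : 0 ≤ γ₈ := zero_le_one.trans hγ₈
  have hγ₈pos : 0 < γ₈ := lt_of_lt_of_le one_pos hγ₈
  have hγB2 : 2 * (γ' * lam.inp.B₀) ≤ 5 * (θ.D : ℝ) * θ.L * B₈ :=
    le_trans (le_add_of_nonneg_left (mul_nonneg h5 hB₀.le)) hγB
  -- PROPOSITION 5 ∃∕! WITH SOURCE in the γ′ letters: the three sourced sockets below member-UNIFORM thresholds (dag-n05-w4)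
  obtain ⟨cP5, hcP5, H5⟩ := exists_uniform_threshold_sp5_src_γ' (𝔸 := θ.𝔸) (γ := γ₈) hD θ.two_le_L hB8' hfreeS hcL hB₀ lam.inp.B₀'_pos hB₀'H hB₂' hBG
    hBR hγ₈0 hγ' hB₀8 hγB2 hc59
  obtain ⟨cPb, hcPb, Hb⟩ := exists_uniform_threshold_sp5base_src_γ' (𝔸 := θ.𝔸) (γ := γ₈) hD θ.two_le_L hfreeS hcL lam.inp.B₀'_pos hB₀'H hB₂' hBG hBR hγ₈0
    hB₈ hB8'
  obtain ⟨cu, cPu, hcu, hcPu, Hu⟩ := exists_uniform_threshold_sp5u_src_γ' (𝔸 := θ.𝔸) (γ := γ₈) hD θ.two_le_L hB8' hcL hB₀ lam.inp.B₀'_pos hB₀'H hB₂' hBG hBR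
    hγ₈0 hγ' hB₀8 hγB2 hc59
  -- ONE threshold for the four Prop-5-type sockets
  have hcP : 0 < min c59 (min cPb (min cP5 cPu)) := lt_min hc59 (lt_min hcPb (lt_min hcP5 hcPu))
  have hP59 : min c59 (min cPb (min cP5 cPu)) ≤ c59 := min_le_left _ _
  have hPb : min c59 (min cPb (min cP5 cPu)) ≤ cPb := (min_le_right _ _).trans (min_le_left _ _)
  have hP5 : min c59 (min cPb (min cP5 cPu)) ≤ cP5 := (min_le_right _ _).trans ((min_le_right _ _).trans (min_le_left _ _))
  have hPu : min c59 (min cPb (min cP5 cPu)) ≤ cPu := (min_le_right _ _).trans ((min_le_right _ _).trans (min_le_right _ _))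
  -- PROPOSITION 3 AS PRINTED on the P-carrier at the law members (this seat's D3, index-map form)
  have hP3 := prop3Printed_zdGF3P_map_γ (𝔸 := θ.𝔸) hD θ.two_le_L lam.inp hB₀β.le (le_of_eq hC₂eq.symm) hcB9 lam.β lam.len
    (fun j : IdxB8SubB θ => j.1.1) (fun j => SB9P j.1.1 j.1.2 j.2)
  -- THEOREM 8 SURVIVING at the P-members (this seat's D9a, sockets served as above)
  have t8 := t8P_famB8OfRecordSubBP_of_socketsSrc_γ' lam hD hcP hcu hcP3 hγ₈ hγ' hγ'' hB hB₀β hB₀8 hγB hγB'' hB8β hB₁eq hB₂eq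
    (fun i hΩ hl α₀ α₁ hα₀ hα₁ hs => Hb i.η i.k i.Ω i.Λs (fun m j => towerBondsP θ.L i.Ω (i.Λs m) j) i.hη i.hk i.hΩ
      hl.toIdxB8Laws.tower_all (SLet i hΩ hl) α₀ α₁ hα₀ hα₁ (hs.trans hPb))
    (fun i hΩ hl α₀ α₁ hα₀ hα₁ hs => H5 i.η i.k i.Ω i.Λs (fun m j => towerBondsP θ.L i.Ω (i.Λs m) j) i.hη i.hΩ
      (B8TowerBondsPrinted.ZdIdx.towerBondsP_laws i).1 (B8TowerBondsPrinted.ZdIdx.towerBondsP_laws i).2 hl.toIdxB8Laws.tower_all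
      hl.trunc_lt hl.trunc_top (SLet i hΩ hl) (SH59src i hΩ hl) α₀ α₁ hα₀ hα₁ (hs.trans hP5))
    (fun i hΩ hl α₀ α₁ hα₀ hα₁ hs => SH59src i hΩ hl α₀ α₁ hα₀ hα₁ (hs.trans hP59))
    (fun i hΩ hl α₀ α₁ hα₀ hα₁ hs => Hu i.η i.k i.Ω i.Λs (fun m j => towerBondsP θ.L i.Ω (i.Λs m) j) i.hη i.hk i.hΩ hΩ
      (B8TowerBondsPrinted.ZdIdx.towerBondsP_laws i).1 (B8TowerBondsPrinted.ZdIdx.towerBondsP_laws i).2 i.htower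
      (SLetUB i hΩ hl) (SH59src i hΩ hl) α₀ α₁ hα₀ hα₁ (hs.trans hPu))
    SB9srcHP
  -- THE γ′ LEAF (dag-n05-w2: Lemma 1 kernel, Thm 2, Prop 3 := hP3, Thm 4; `p5e p5u p6 p7 t8` passed) at `ι := (·.1.1)`, source premiss ρ2, `LanF146`, zero source
  have leaf := b8LeafRS_zdGF3HP_mapJ_γ' (𝔸 := θ.𝔸) hD θ.two_le_L θ.L lam.β lam.len lam.inp hB₀β (le_of_eq hC₂eq) hcu hcP hγ' hB₈ hB₀8 hB8' hγB
    (fun j : IdxB8SubB θ => j.1.1)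
    (fun (j : IdxB8SubB θ) (f : Site θ.D → θ.𝔸) (U₀ : Site θ.D → Fin θ.D → θ.𝔸ˣ) (a0 b0 : ℝ) =>
      (InR138 θ.L j.1.1.k j.1.1.η (j.1.1.Ω 0) (j.1.1.Λs j.1.1.k) U₀ f ∧ (∀ x, IsSelfAdjoint (f x)) ∧ (∀ x, x ∉ j.1.1.Ω 0 → f x = 0) ∧
          Bdd θ.L j.1.1.k j.1.1.η (-(2 : ℝ)) (fun jj (x : Site θ.D) => x ∈ j.1.1.Ω jj) f) ∧
        msup θ.L j.1.1.k j.1.1.η (-(2 : ℝ)) (fun jj (x : Site θ.D) => x ∈ j.1.1.Ω jj) f < γ₈ * (a0 + b0))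
    (fun (j : IdxB8SubB θ) (U₀ : Site θ.D → Fin θ.D → θ.𝔸ˣ) (f : Site θ.D → θ.𝔸) (m : ℕ) (W : Site θ.D → Fin θ.D → θ.𝔸ˣ) =>
      LanF146 θ.L j.1.1.k j.1.1.η (j.1.1.Ω 0) j.1.1.Λs U₀ f m W)
    (fun j α₀ α₁ hα₀ hα₁ hs => Hb j.1.1.η j.1.1.k j.1.1.Ω j.1.1.Λs (fun m jj => towerBondsP θ.L j.1.1.Ω (j.1.1.Λs m) jj) j.1.1.hη j.1.1.hk j.1.1.hΩ
      (IdxB8SubB.tower_all j) (SLet j.1.1 j.1.2 j.2) α₀ α₁ hα₀ hα₁ (hs.trans hPb))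
    (fun j α₀ α₁ hα₀ hα₁ hs => H5 j.1.1.η j.1.1.k j.1.1.Ω j.1.1.Λs (fun m jj => towerBondsP θ.L j.1.1.Ω (j.1.1.Λs m) jj) j.1.1.hη j.1.1.hΩ
      (B8TowerBondsPrinted.ZdIdx.towerBondsP_laws j.1.1).1 (B8TowerBondsPrinted.ZdIdx.towerBondsP_laws j.1.1).2 (IdxB8SubB.tower_all j)
      j.2.trunc_lt j.2.trunc_top (SLet j.1.1 j.1.2 j.2) (SH59src j.1.1 j.1.2 j.2) α₀ α₁ hα₀ hα₁ (hs.trans hP5))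
    (fun j α₀ α₁ hα₀ hα₁ hs => SH59src j.1.1 j.1.2 j.2 α₀ α₁ hα₀ hα₁ (hs.trans hP59))
    (fun j α₀ α₁ hα₀ hα₁ hs => Hu j.1.1.η j.1.1.k j.1.1.Ω j.1.1.Λs (fun m jj => towerBondsP θ.L j.1.1.Ω (j.1.1.Λs m) jj) j.1.1.hη j.1.1.hk j.1.1.hΩ j.1.2
      (B8TowerBondsPrinted.ZdIdx.towerBondsP_laws j.1.1).1 (B8TowerBondsPrinted.ZdIdx.towerBondsP_laws j.1.1).2 j.1.1.htower
      (SLetUB j.1.1 j.1.2 j.2) (SH59src j.1.1 j.1.2 j.2) α₀ α₁ hα₀ hα₁ (hs.trans hPu))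
    (0 : Site θ.D → θ.𝔸)
    (fun j α₀ α₁ hα₀ hα₁ U₀ _ =>
      ⟨⟨inR138_zero j.1.1.η θ.L U₀ j.1.1.k (j.1.1.Ω 0) (j.1.1.Λs j.1.1.k), fun _ => IsSelfAdjoint.zero θ.𝔸, fun _ _ => rfl,
        bdd_of_forall (c := 0) fun _ _ _ _ => by simp⟩,
       lt_of_le_of_lt (msup_le le_rfl fun _ _ _ _ => by simp) (mul_pos hγ₈pos (add_pos hα₀ hα₁))⟩)
    (fun j U₀ W => lanF146_zero_iff θ.L j.1.1.k j.1.1.η (j.1.1.Ω 0) j.1.1.Λs U₀ j.1.1.k W)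
    (fun j => j.1.2) (fun j => IdxB8SubB.tower_all j) hP3 (toAxial := fun j => lam.toAxial j.1) p5e p5u p6 p7 t8
  rw [b8LeafOfRecordSubBP_cutSubB_iff, hB₁']
  exact leaf

end KnitP

#print axioms b8LeafOfRecordSubBP_cutSubB_of_knit_lettersSrc_γ'

end Summit.QuantumFields.YangMills.BalabanUVNodes.N05SubBPKnitGammaPrime

end
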